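import Mathlib
import Literature.Computability.AlgebraicComplexity.StandardFamilies
import Literature.Computability.AlgebraicComplexity.DeterminantalComplexity
import Literature.AlgebraicGeometry.DeterminantalHypersurfaces.KernerVinnikovSaturation
import Summits.ValiantsHypothesis.ValiantsHypothesis.Theorems.RefutationDegreeDefs
import Summits.ValiantsHypothesis.ValiantsHypothesis.Theorems.RefutationDegreeRefutationBarrierPencilCoeff

/-!
# Crux `RefutationBarrier` (stmt-ValiantsHypothesis-5642), line `Sketch_ideator5`: stub T1,
border transfer to linear sections (`stub_borderSections`)

If `per_n` is a coefficientwise limit of determinants `P_j = det A^{(j)}(x)` of size-`m`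
affine pencils `A^{(j)}(x) = A₀^{(j)} + Σ_e x_e A_e^{(j)}` (`InBorder n m`, `n ≤ m`), then for
every tuple `L = (L_e)` of linear forms in `N` variables `y` and every covector `l` there are
degree-`m` FORMS `G_j(y)` with size-`m` (linear) determinantal representations converging
coefficientwise to `ℓ^{m-n} · per_n(L(y))`, `ℓ = Σ lᵢ yᵢ`.

Proof (homogenisation).  Put `H_j(t, x) := det (t A₀^{(j)} + Σ_e x_e A_e^{(j)})`, a form of
degree `m` in the `n² + 1` variables `(t, x)` with `H_j(1, x) = P_j(x)`, and `G_j := H_j(ℓ, L)`.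
For a form `H` of degree `m` the coefficient of `t^{m-|μ|} x^μ` in `H` is the coefficient of
`x^μ` in `H(1, x)` (`coeff_some_dehomog`), so every coefficient of `H_j` converges to the
corresponding coefficient of `H_∞ := t^{m-n} · per_n(x)` (also a form of degree `m`, with
`H_∞(1, x) = per_n`); since all these polynomials are supported on the finite set of exponents
of degree `≤ m`, the coefficients of `G_j = H_j(ℓ, L)` (fixed finite linear combinations of those
of `H_j`) converge to those of `H_∞(ℓ, L) = ℓ^{m-n} · per_n ∘ L`.
-/

set_option linter.dupNamespace false

noncomputable section

namespace Summit.ValiantsHypothesis.ValiantsHypothesis.Theorems.RefutationDegree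

open scoped BigOperators
open Filter Topology MvPolynomial
open Literature.Computability.AlgebraicComplexity (perPoly perPoly_isHomogeneous HasDetRepr)

/-! ## Dehomogenisation bookkeeping -/

section Dehomogenisation

variable {α : Type*} {R : Type*} [CommSemiring R]

/-- The degree of an exponent in the variables `(t, x)` is its `t`-exponent plus the degree of
its `x`-part. [folklore] -/
private theorem degree_eq_none_add (κ : Option α →₀ ℕ) :
    κ.degree = κ none + κ.some.degree := by
  rw [Finsupp.degree_apply, Finsupp.degree_apply]
  have h := Finsupp.sum_option_index κ (fun _ e => e) (fun _ => rfl) (fun _ _ _ => rfl)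
  simpa only [Finsupp.sum] using h

/-- Setting `t = 1` sends the monomial `c · t^a x^μ` to `c · x^μ`. [folklore] -/
private theorem aeval_elim_one_X_monomial (κ : Option α →₀ ℕ) (c : R) :
    aeval (fun o : Option α => o.elim (1 : MvPolynomial α R) X) (monomial κ c) =
      monomial κ.some c := by
  rw [aeval_monomial, Finsupp.prod_option_index κ
    (fun o e => (Option.elim o (1 : MvPolynomial α R) X) ^ e) (fun _ => pow_zero _)
    (fun _ _ _ => pow_add _ _ _)]
  simp only [Option.elim_none, Option.elim_some, one_pow, one_mul, algebraMap_eq]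
  rw [monomial_eq]

/-- **Dehomogenisation of coefficients.**  For a form `H` of degree `m` in the variables `(t, x)`
and an exponent `κ` of degree `m`, the coefficient of `(t, x)^κ` in `H` is the coefficient of
`x^{κ|ₓ}` in `H(1, x)`. [folklore] -/
private theorem coeff_some_dehomog {H : MvPolynomial (Option α) R} {m : ℕ}
    (hH : H.IsHomogeneous m) {κ : Option α →₀ ℕ} (hκ : κ.degree = m) :
    coeff κ.some (aeval (fun o : Option α => o.elim (1 : MvPolynomial α R) X) H) =
      coeff κ H := by
  classical
  conv_lhs => rw [H.as_sum, map_sum]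
  rw [coeff_sum]
  simp_rw [aeval_elim_one_X_monomial, coeff_monomial]
  rw [Finset.sum_eq_single κ, if_pos rfl]
  · intro κ' hκ' hne
    rw [if_neg]
    intro heq
    have hd' : κ'.degree = m := by
      by_contra hc
      exact (mem_support_iff.mp hκ') (hH.coeff_eq_zero hc)
    apply hne
    ext o
    rcases o with _ | a
    · have h1 := degree_eq_none_add κ'
      have h2 := degree_eq_none_add κ
      rw [heq] at h1
      omega
    · simpa only [Finsupp.some_apply] using DFunLike.congr_fun heq a
  · intro hκs
    rw [if_pos rfl]
    exact notMem_support_iff.mp hκs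

/-- Coefficients of a substitution as a FIXED finite linear combination of the coefficients of
the substituted polynomial, over any finite set of exponents containing its support.
[folklore] -/
private theorem coeff_aeval_eq_sum {σ τ : Type*} (T : Finset (σ →₀ ℕ)) (p : MvPolynomial σ R)
    (hp : p.support ⊆ T) (f : σ → MvPolynomial τ R) (ν : τ →₀ ℕ) :
    coeff ν (aeval f p) = ∑ κ ∈ T, coeff κ p * coeff ν (κ.prod fun i e => f i ^ e) := by
  have h1 : aeval f p = ∑ κ ∈ T, aeval f (monomial κ (coeff κ p)) := by
    conv_lhs => rw [p.as_sum, map_sum]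
    exact Finset.sum_subset hp fun κ _ hκ => by
      rw [notMem_support_iff.mp hκ, monomial_zero, map_zero]
  rw [h1, coeff_sum]
  refine Finset.sum_congr rfl fun κ _ => ?_
  rw [aeval_monomial, algebraMap_eq, coeff_C_mul]

end Dehomogenisation

/-! ## The homogenised pencil -/

section HomPencil

variable {n m : ℕ}

/-- The approximants `P_j = det A^{(j)}(x)` of a border sequence converge coefficientwise to
`per_n`. [folklore] -/
private theorem tendsto_coeff_approximant {A : ℕ → (Unk n m → ℂ)}
    (hA : ∀ μ, Tendsto (fun k => eval (A k) ((defect n m).coeff μ)) atTop (𝓝 0))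
    (μ : (Fin n × Fin n) →₀ ℕ) :
    Tendsto (fun j => (MvPolynomial.map (eval (A j)) (pencil n m).det).coeff μ) atTop
      (𝓝 ((perPoly (Fin n) ℂ).coeff μ)) := by
  have h1 : (fun j => (MvPolynomial.map (eval (A j)) (pencil n m).det).coeff μ) =
      fun j => eval (A j) ((defect n m).coeff μ) + (perPoly (Fin n) ℂ).coeff μ := by
    funext j
    rw [coeff_defect, map_sub, eval_C, coeff_map, sub_add_cancel]
  rw [h1]
  simpa using (hA μ).add_const ((perPoly (Fin n) ℂ).coeff μ)

/-- The entries of the homogenised pencil `t A₀ + Σ_e x_e A_e` are linear forms in `(t, x)`.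
[folklore] -/
private theorem isHomogeneous_homPencil_entry (a : Unk n m → ℂ)
    {M : Matrix (Fin m) (Fin m) (MvPolynomial (Option (Fin n × Fin n)) ℂ)}
    (hM : ∀ i k, M i k =
      C (a (none, (i, k))) * X none + ∑ e, C (a (some e, (i, k))) * X (some e))
    (i k : Fin m) : (M i k).IsHomogeneous 1 := by
  rw [hM]
  exact (isHomogeneous_C_mul_X _ _).add
    (IsHomogeneous.sum _ _ _ fun e _ => isHomogeneous_C_mul_X _ _)

/-- The homogenised pencil has a determinant which is a form of degree `m`. [folklore] -/
private theorem isHomogeneous_det_homPencil (a : Unk n m → ℂ)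
    {M : Matrix (Fin m) (Fin m) (MvPolynomial (Option (Fin n × Fin n)) ℂ)}
    (hM : ∀ i k, M i k =
      C (a (none, (i, k))) * X none + ∑ e, C (a (some e, (i, k))) * X (some e)) :
    M.det.IsHomogeneous m := by
  simpa only [Fintype.card_fin] using
    Literature.AlgebraicGeometry.DeterminantalHypersurfaces.isHomogeneous_det_of_linear
      (isHomogeneous_homPencil_entry a hM)

/-- Setting `t = 1` in the determinant of the homogenised pencil recovers the approximant
`det A(x)`. [folklore] -/
private theorem aeval_elim_det_homPencil (a : Unk n m → ℂ)
    {M : Matrix (Fin m) (Fin m) (MvPolynomial (Option (Fin n × Fin n)) ℂ)}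
    (hM : ∀ i k, M i k =
      C (a (none, (i, k))) * X none + ∑ e, C (a (some e, (i, k))) * X (some e)) :
    aeval (fun o : Option (Fin n × Fin n) => o.elim (1 : MvPolynomial (Fin n × Fin n) ℂ) X)
      M.det = MvPolynomial.map (eval a) (pencil n m).det := by
  rw [AlgHom.map_det, RingHom.map_det, AlgHom.mapMatrix_apply, RingHom.mapMatrix_apply]
  refine congrArg Matrix.det ?_
  ext i k
  have hcomm : ∀ (b : ℂ) (e : Fin n × Fin n),
      (C b * X e : MvPolynomial (Fin n × Fin n) ℂ) = X e * C b := fun b e => mul_comm _ _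
  simp only [Matrix.map_apply, hM, pencil, Matrix.of_apply, map_add, map_sum, map_mul, aeval_C,
    algebraMap_eq, aeval_X, Option.elim_none, Option.elim_some, mul_one, map_C, map_X, eval_X,
    hcomm]

end HomPencil

/-! ## The stub -/

/-- **Stub T1 (border sections).**  If `per_n` is a coefficientwise limit of determinants of
size-`m` affine pencils (`InBorder n m`, `n ≤ m`), then for every tuple `L` of linear forms in
`N` variables (a linear section) and every covector `l` (a slice of the homogenising variable)
there is a sequence of degree-`m` FORMS `G_j` in the `N` section variables, each with an affine
(indeed linear) determinantal representation of size `m`, converging coefficientwise to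
`ℓ^{m-n} · (per_n ∘ L)`, `ℓ = Σ lᵢ yᵢ`.  (Take `G_j = det(ℓ·A₀^{(j)} + Σ_e L_e·A_e^{(j)})` for
the border sequence `A^{(j)}` and use the homogenisation identity: the coefficients of the form
`det(t A₀ + Σ_e x_e A_e)` of degree `m` are those of `det(A₀ + Σ_e x_e A_e)`.) [folklore] -/
theorem stub_borderSections {n m N : ℕ} (hnm : n ≤ m) (h : InBorder n m)
    (L : Fin n × Fin n → MvPolynomial (Fin N) ℂ) (hL : ∀ e, (L e).IsHomogeneous 1)
    (l : Fin N → ℂ) :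
    ∃ G : ℕ → MvPolynomial (Fin N) ℂ,
      (∀ j, HasDetRepr (G j) m ∧ (G j).IsHomogeneous m) ∧
      ∀ ν : Fin N →₀ ℕ, Tendsto (fun j => (G j).coeff ν) atTop
        (𝓝 (((∑ i, C (l i) * X i) ^ (m - n) * aeval L (perPoly (Fin n) ℂ)).coeff ν)) := by
  classical
  obtain ⟨A, hA⟩ := h
  -- the homogenised pencils `t A₀^{(j)} + Σ_e x_e A_e^{(j)}` over `ℂ[t, x]`, `t = X none`
  obtain ⟨HM, hHM⟩ :
      ∃ HM : ℕ → Matrix (Fin m) (Fin m) (MvPolynomial (Option (Fin n × Fin n)) ℂ),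
        ∀ j i k, HM j i k = C (A j (none, (i, k))) * X none +
        ∑ e, C (A j (some e, (i, k))) * X (some e) := by
    refine ⟨fun j => Matrix.of fun i k => C (A j (none, (i, k))) * X none +
        ∑ e, C (A j (some e, (i, k))) * X (some e), fun j i k => ?_⟩
    simp only [Matrix.of_apply]
  have hHdet : ∀ j, (HM j).det.IsHomogeneous m := fun j =>
    isHomogeneous_det_homPencil (A j) (hHM j)
  -- the limit form `H_∞ = t^{m-n} · per_n(x)`
  obtain ⟨Hinf, hHinf⟩ : ∃ Hinf : MvPolynomial (Option (Fin n × Fin n)) ℂ,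
      Hinf = X none ^ (m - n) * rename some (perPoly (Fin n) ℂ) := ⟨_, rfl⟩
  have hHinf_hom : Hinf.IsHomogeneous m := by
    have h1 := (isHomogeneous_X_pow (R := ℂ) (none : Option (Fin n × Fin n)) (m - n)).mul
      ((perPoly_isHomogeneous (n := Fin n) (k := ℂ)).rename_isHomogeneous (f := some))
    rw [Fintype.card_fin, Nat.sub_add_cancel hnm] at h1
    rw [hHinf]
    exact h1
  have hπinf : aeval (fun o : Option (Fin n × Fin n) =>
      o.elim (1 : MvPolynomial (Fin n × Fin n) ℂ) X) Hinf = perPoly (Fin n) ℂ := by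
    rw [hHinf, map_mul, map_pow, aeval_X, Option.elim_none, one_pow, one_mul, aeval_rename]
    have : ((fun o : Option (Fin n × Fin n) =>
        o.elim (1 : MvPolynomial (Fin n × Fin n) ℂ) X) ∘ some) = X := funext fun _ => rfl
    rw [this, aeval_X_left_apply]
  -- the substitution `t ↦ ℓ = Σ lᵢ yᵢ`, `x_e ↦ L_e`
  obtain ⟨ℓ, hℓ⟩ : ∃ ℓ : MvPolynomial (Fin N) ℂ, ℓ = ∑ i, C (l i) * X i := ⟨_, rfl⟩
  obtain ⟨ψ, hψn, hψs⟩ : ∃ ψ : Option (Fin n × Fin n) → MvPolynomial (Fin N) ℂ,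
      ψ none = ℓ ∧ ψ ∘ some = L := ⟨fun o => o.elim ℓ L, rfl, rfl⟩
  have hψ1 : ∀ o, (ψ o).IsHomogeneous 1 := by
    rintro (_ | e)
    · rw [hψn, hℓ]
      exact IsHomogeneous.sum _ _ _ fun i _ => isHomogeneous_C_mul_X _ _
    · have := congr_fun hψs e
      rw [Function.comp_apply] at this
      rw [this]
      exact hL e
  have hψinf : aeval ψ Hinf = ℓ ^ (m - n) * aeval L (perPoly (Fin n) ℂ) := by
    rw [hHinf, map_mul, map_pow, aeval_X, hψn, aeval_rename, hψs]
  -- coefficientwise convergence `H_j → H_∞`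
  have hcoeffH : ∀ κ : Option (Fin n × Fin n) →₀ ℕ,
      Tendsto (fun j => coeff κ (HM j).det) atTop (𝓝 (coeff κ Hinf)) := by
    intro κ
    by_cases hκ : κ.degree = m
    · have h1 : ∀ j, coeff κ (HM j).det =
          coeff κ.some (MvPolynomial.map (eval (A j)) (pencil n m).det) := fun j => by
        rw [← aeval_elim_det_homPencil (A j) (hHM j), coeff_some_dehomog (hHdet j) hκ]
      have h2 : coeff κ Hinf = coeff κ.some (perPoly (Fin n) ℂ) := by
        rw [← coeff_some_dehomog hHinf_hom hκ, hπinf]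
      simp only [h1, h2]
      exact tendsto_coeff_approximant hA κ.some
    · have h1 : ∀ j, coeff κ (HM j).det = 0 := fun j => (hHdet j).coeff_eq_zero hκ
      rw [hHinf_hom.coeff_eq_zero hκ]
      simp only [h1]
      exact tendsto_const_nhds
  -- all the `H_j` and `H_∞` are supported on the exponents of degree `≤ m`
  obtain ⟨T, hT⟩ : ∃ T : Finset (Option (Fin n × Fin n) →₀ ℕ),
      ∀ {H : MvPolynomial (Option (Fin n × Fin n)) ℂ}, H.IsHomogeneous m →
        H.support ⊆ T := by
    refine ⟨(Finsupp.finite_of_degree_le m).toFinset, fun {H} hH κ hκ => ?_⟩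
    rw [Set.Finite.mem_toFinset, Set.mem_setOf_eq]
    have hd : κ.degree = m := by
      by_contra hc
      exact (mem_support_iff.mp hκ) (hH.coeff_eq_zero hc)
    exact hd.le
  refine ⟨fun j => aeval ψ (HM j).det, fun j => ⟨?_, ?_⟩, fun ν => ?_⟩
  · -- the linear determinantal representation `ℓ A₀^{(j)} + Σ_e L_e A_e^{(j)}`
    refine ⟨(aeval ψ).mapMatrix (HM j), fun i k => ?_, (AlgHom.map_det _ _).symm⟩
    rw [AlgHom.mapMatrix_apply, Matrix.map_apply]
    have h1 : (aeval ψ (HM j i k)).IsHomogeneous 1 := by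
      simpa only [mul_one] using
        (isHomogeneous_homPencil_entry (A j) (hHM j) i k).aeval ψ hψ1
    exact h1.totalDegree_le
  · simpa only [one_mul] using (hHdet j).aeval ψ hψ1
  · show Tendsto (fun j => coeff ν (aeval ψ (HM j).det)) atTop
      (𝓝 (coeff ν ((∑ i, C (l i) * X i) ^ (m - n) * aeval L (perPoly (Fin n) ℂ))))
    rw [← hℓ, ← hψinf, coeff_aeval_eq_sum T Hinf (hT hHinf_hom) ψ ν]
    have h3 : (fun j => coeff ν (aeval ψ (HM j).det)) =
        fun j => ∑ κ ∈ T, coeff κ (HM j).det * coeff ν (κ.prod fun o e => ψ o ^ e) :=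
      funext fun j => coeff_aeval_eq_sum T _ (hT (hHdet j)) ψ ν
    rw [h3]
    exact tendsto_finsetSum T fun κ _ => (hcoeffH κ).mul_const _

end Summit.ValiantsHypothesis.ValiantsHypothesis.Theorems.RefutationDegree

end
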